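import Summits.QuantumFields.BalabanUV.T4Continuum.Support.ShellMeasureExpDuhamelSUN
import Literature.MathematicalPhysics.QuantumFieldTheory.Balaban1983to89.T4EMLTangentInjective
import Literature.Analysis.Calculus.ApproximatesLinearHausdorff
import Literature.Analysis.Calculus.ExpLocalLieSubalgebra
import Mathlib.Geometry.Euclidean.Volume.Measure
import Mathlib.Topology.Algebra.Group.Compact

/-!
# `T4Continuum.ShellMeasureHaarHausdorffSUN` — THE HAAR MEASURE OF `SU(N)` IS THE NORMALISED `d_N`-DIMENSIONAL
# EUCLIDEAN HAUSDORFF MEASURE of `SU(N) ⊂ (M_N(ℂ), Re Tr A*B)`, for EVERY `N`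
# (cell `pub-balaban`, sub-cell `t4`, spine estimate NE7c (node U5b); ROUND-2 crew `t4-ne7c-formalise-*`; the (CH)₁ line
# for `SU(N)`, `N ≥ 3` — GAPS G-ne7cL04-1, the ONE located binder `hCH` of the `SU(N)` engine
# `ShellMeasureRealizedSUN.slotAntiConcentration_realized_suN_expJac` beyond the `SU(2)` road (row S3, c5: optional and
# last); leaf-09-g5's route memo `ROUTE-CH1-SUN.md` STEPS 3–5 replaced by the HAUSDORFF ROUTE: this file = (H), the
# group-side half; seat `b2b-balaban-t4-ne7c-formalise-leaf-10` (gen 5); tree target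
# `Summits/QuantumFields/BalabanUV/T4Continuum/Support/`; ADDITIVE — imports S3 f1 `ShellMeasureExpChartSUN` (the chart
# `expPtSU`, `genSU`, `coordSU`, `dimSU`), the tree's `T4EMLTangentInjective` (for `star_mlog_of_unitary`,
# `ExpMeanLog.trace_mlog_eq_zero`, `MatrixLog.exp_mlog`, `MatrixNorms`), `Literature.Analysis.Calculus.
# ApproximatesLinearHausdorff` (Federer's `λ^{±d}` estimates for `μHE[d]`), `…ExpLocalLieSubalgebra` (`contDiff_exp`) and
# Mathlib's `Geometry.Euclidean.Volume.Measure` (`μHE[d]`); modifies nothing)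

HONEST FRAMING.  Finite four-torus programme, rung (B)+1 only — NOT infinite volume, NOT a mass gap, NOT the Clay
problem, NOT summit progress.  Nothing of [Balaban 1983–89] is mentioned or asserted; NE7c NOT proved and not touched
(spine PROVED 0/9); (CH)₁ for `N ≥ 3` stays DISPLAYED until the area-formula half (AF) and the Jacobian identity
(`normDet D(exp∘genSU)_v = expJacSU v` off the non-regular cone, = STEP 2 of the memo) are in the tree.  Every
declaration is [folklore] measure theory on compact matrix groups (kernel-checked, 0 sorry, 0 citations, no
`def … : Prop`; the data defs `matrixBorel`, `genSUli`, `genSUL`, `expM`, `hausdorffSU`, `mulLeftIsometry`, `nbhdOne` are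
objects, not statements).  v1.1 status note: (AF)/(CB) have landed — (CH)₁ is a THEOREM for every `N ≥ 1`, `0 ≤ S ≤ π`.
HONEST DEPENDENCY (cell, verbatim): continuum YM on T⁴ ⇐ BetaPertH ∧ nine spine estimates (0/9 proved); BetaPertH ⇐ (D1) ∧
(D4) ∧ CAP+tail; G-an2-4 gates asym, D1 and NE2/3/4.

THE POINT (`haar_eq_smul_hausdorffSU`).  With `d_N = dimSU N = dim_ℝ 𝔰𝔲(N)` and `μHE[d]` Mathlib's `d`-dimensional
Euclidean Hausdorff measure (normalised to Lebesgue measure on `ℝ^d`), on the compact group `SUN N ⊂ M_N(ℂ)` carrying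
the Hilbert–Schmidt (Frobenius) metric `‖A − B‖_HS` (the tree's `QuantumLattice.frobeniusInnerProductSpace`, `Re Tr A*B`):

  `HaarData.haar = (μHE[d_N] (SU N))⁻¹ • μHE[d_N]`   on `SUN N`,   `0 < μHE[d_N] (SU N) < ∞`,

i.e. the normalised Haar measure of `SU(N)` (`HaarData.haar = haarProbability = haarMeasure ⊤` by `rfl`) IS the normalised
Hausdorff measure of its own dimension.  Proof: (§3) left translations `h ↦ g·h` are ISOMETRIES of the Hilbert–Schmidt
metric (`‖gA‖_HS = ‖A‖_HS` for unitary `g`, `norm_unitary_mul`), and `μHE[d]` is invariant under isometries (Mathlib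
`IsometryEquiv.measurePreserving_euclideanHausdorffMeasure`) — so `hausdorffSU N := μHE[d_N]` is LEFT-INVARIANT
(`map_mul_left_hausdorffSU`); it is FINITE (`hausdorffSU_univ_lt_top`): the chart neighbourhood
`nbhdOne = {Σ|(W−1)_ij|² < (3(N+1))⁻²}` of `1` lies in the chart image `expPtSU '' B̄_N` (§1, the tree's matrix logarithm:
`W = exp (mlog W)` with `mlog W` skew-Hermitian (`T4EMLTangentInjective.star_mlog_of_unitary`), trace-free
(`ExpMeanLog.trace_mlog_eq_zero`) and `Σ|(mlog W)_ij|² ≤ N`), the chart image of a ball is a LIPSCHITZ image of a ball of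
`E_N = ℝ^{d_N}` (§2: `exp ∘ genSU` is `C¹`, `ContDiffOn.exists_lipschitzOnWith`), hence of finite `μHE[d_N]`-measure
(`LipschitzOnWith.hausdorffMeasure_image_le`), and finitely many left translates of `nbhdOne` cover the compact group
(`compact_covered_by_mul_left_translates`); it is NON-ZERO (`hausdorffSU_univ_pos`): at the centre the chart
`v ↦ exp (genSU v)` has strict derivative the ISOMETRIC EMBEDDING `genSUL : E_N → M_N(ℂ)` (`normDet = 1`), so it is
`δ`-approximately linear near `0` and Federer's lower estimate `mul_le_euclideanHausdorffMeasure_image_of_lt_normDet`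
(tree, `ApproximatesLinearHausdorff`) gives `μHE[d_N](exp(genSU(s))) ≥ ½ vol(s) > 0` for a neighbourhood `s` of `0`.
Uniqueness of left-invariant measures on the second-countable compact group (Mathlib `Measure.haarMeasure_unique`, the
pattern of `T4HaarSUNLocalDiffeo.map_toSU_haarProbability`) then gives the identity (§4), and
`haar_image_expPtSU : Haar (expPtSU '' s) = (μHE[d_N](SU N))⁻¹ · μHE[d_N] (exp (genSU '' s))` is the form the AREA
FORMULA consumes (Federer 3.2.3/3.2.5 in positive codimension IS in the tree:
`Literature.Analysis.Calculus.AreaFormulaHausdorff.map_withDensity_normDet_eq_euclideanHausdorffMeasure`) — the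
companion file (AF) turns it into (CH)₁ with the density `normDet D(exp∘genSU)_v`, for every `N` and every `S < π`.

MEASURABLE STRUCTURES.  `M_N(ℂ) = MatC N` carries the LOCAL instances `hsInnerProductSpace` (= the tree's Frobenius
inner product), `matrixBorel` (= `borel`), `borelSpace_matrix(')`, `completeSpace_matrix`, and `SUN N` the tree's
`instMeasurableSpace` (+ `borelSpace_SUN`) — re-activate downstream by `attribute [local instance]`.
WHAT THIS DOES NOT DO.  No chart-side density ((AF), STEP 2 and the cone's nullity are separate files); (CH)₁ for
`N ≥ 3` NOT discharged here; nothing of Bałaban's; NE7c NOT proved.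
-/

noncomputable section

namespace Summit.QuantumFields.BalabanUV.T4Continuum.ShellMeasureHaarHausdorffSUN

open MeasureTheory Measure Set Metric Function Filter Topology
open scoped ENNReal NNReal Matrix
open Literature.MathematicalPhysics.QuantumFieldTheory.Balaban1983to89
open Literature.MathematicalPhysics.QuantumLattice (frobenius_inner_def)
open T4AdjointCovarianceUnitary (lieSU expSU mem_lieSU_iff coe_expSU)
open ShellMeasureExpChartSUN
open ShellMeasureExpDuhamelSUN (genSUL genSUL_apply)

variable {N : ℕ}

variable (N) in
/-- `M_N(ℂ)` (a reducible abbreviation). [folklore] -/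
abbrev MatC : Type := Matrix (Fin N) (Fin N) ℂ
/-! ## §1 The exponential chart FILLS a neighbourhood of `1` (operator-norm section: the tree's matrix logarithm) -/

section OpNorm

open scoped Matrix.Norms.L2Operator
open MatrixLog (mlog)

/-- an entrywise smallness `Σ |(W − 1)_ij|² < r²` forces `‖W − 1‖_op < r`. [folklore] -/
theorem opNorm_sub_one_lt_of_sum_sq_lt {W : (MatC N)} {r : ℝ} (hr : 0 ≤ r)
    (h : ∑ i, ∑ j, ‖(W - 1) i j‖ ^ 2 < r ^ 2) : ‖W - 1‖ < r := by
  by_contra hc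
  have : r ^ 2 ≤ ‖W - 1‖ ^ 2 := pow_le_pow_left₀ hr (not_lt.mp hc) 2
  linarith [MatrixNorms.opNorm_sq_le_sum_norm_sq (W - 1)]

/-- **THE EXPONENTIAL CHART FILLS A NEIGHBOURHOOD OF `1` IN `SU(N)`**: every `W ∈ SU(N)` with
`Σ |(W − 1)_ij|² < (3(N+1))⁻²` is `exp Z` for a trace-free skew-Hermitian `Z` (the tree's `mlog W`) with `Σ |Z_ij|² ≤ N`.
[folklore] -/
theorem exists_lieSU_exp_eq {W : (MatC N)} (hW : W ∈ Matrix.specialUnitaryGroup (Fin N) ℂ)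
    (hsmall : ∑ i, ∑ j, ‖(W - 1) i j‖ ^ 2 < (1 / (3 * ((N : ℝ) + 1))) ^ 2) :
    ∃ Z : (MatC N), Z ∈ lieSU (Fin N) ∧ NormedSpace.exp Z = W ∧ ∑ i, ∑ j, ‖Z i j‖ ^ 2 ≤ N := by
  have hN1 : (0 : ℝ) < 3 * ((N : ℝ) + 1) := by positivity
  have hop : ‖W - 1‖ < 1 / (3 * ((N : ℝ) + 1)) := opNorm_sub_one_lt_of_sum_sq_lt (by positivity) hsmall
  have hr3 : ‖W - 1‖ ≤ 1 / 3 := hop.le.trans (one_div_le_one_div_of_le (by norm_num) (by nlinarith))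
  have hr2 : ‖W - 1‖ < 1 / 2 := lt_of_le_of_lt hr3 (by norm_num)
  have hr1 : ‖W - 1‖ < 1 := lt_of_le_of_lt hr3 (by norm_num)
  have hπ : (Fintype.card (Fin N) : ℝ) * ‖W - 1‖ < Real.pi := by
    rw [Fintype.card_fin]
    have h1 : (N : ℝ) * ‖W - 1‖ ≤ (N : ℝ) * (1 / (3 * ((N : ℝ) + 1))) :=
      mul_le_mul_of_nonneg_left hop.le (Nat.cast_nonneg N)
    have h2 : (N : ℝ) * (1 / (3 * ((N : ℝ) + 1))) ≤ 1 / 3 := by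
      rw [mul_one_div, div_le_iff₀ hN1]
      nlinarith
    linarith [Real.pi_gt_three]
  have hWu : W ∈ Matrix.unitaryGroup (Fin N) ℂ := (Matrix.mem_specialUnitaryGroup_iff.mp hW).1
  refine ⟨mlog W, ?_, MatrixLog.exp_mlog hr1, ?_⟩
  · rw [mem_lieSU_iff]
    exact ⟨T4EMLTangentInjective.star_mlog_of_unitary hWu hr2, ExpMeanLog.trace_mlog_eq_zero hW hr3 hπ⟩
  · have hZ : ‖mlog W‖ ≤ 1 := (MatrixLog.norm_mlog_le_two_mul hr2.le).trans (by linarith)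
    calc ∑ i, ∑ j, ‖mlog W i j‖ ^ 2 = ∑ j, ∑ i, ‖mlog W i j‖ ^ 2 := Finset.sum_comm
      _ ≤ ∑ _j : Fin N, ‖mlog W‖ ^ 2 :=
          Finset.sum_le_sum fun j _ => MatrixNorms.sum_norm_sq_col_le_opNorm_sq (mlog W) j
      _ = N * ‖mlog W‖ ^ 2 := by rw [Finset.sum_const, Finset.card_univ, Fintype.card_fin, nsmul_eq_mul]
      _ ≤ N := by
          rw [← mul_one (N : ℝ), mul_assoc, one_mul]
          exact mul_le_mul_of_nonneg_left (by nlinarith [norm_nonneg (mlog W)]) (Nat.cast_nonneg N)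

end OpNorm

/-! ## §2 The ambient chart map `v ↦ exp (genSU v) ∈ M_N(ℂ)` in the Hilbert–Schmidt (Frobenius) geometry -/

section Frobenius

open scoped Matrix.Norms.Frobenius

/-- the real Hilbert–Schmidt inner product `Re Tr A*B` on `M_N(ℂ)` (= the tree's `QuantumLattice.frobeniusInnerProductSpace`,
under this file's name, so that it is a LOCAL instance here and downstream). [folklore] -/
@[reducible] def hsInnerProductSpace : InnerProductSpace ℝ (MatC N) :=
  Literature.MathematicalPhysics.QuantumLattice.frobeniusInnerProductSpace

/-- the Borel σ-algebra of `M_N(ℂ)` (product topology = Frobenius-norm topology; matrices carry no global measurable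
structure — the canonical `borel`, so that every file declaring the same local instance sees the same measures).
[folklore] -/
instance matrixBorel : MeasurableSpace (MatC N) := borel (MatC N)

/-- … which is a Borel structure for the Frobenius-norm topology, by definition … [folklore] -/
instance borelSpace_matrix :
    @BorelSpace (MatC N) (PseudoMetricSpace.toUniformSpace (α := (MatC N))).toTopologicalSpace matrixBorel := ⟨rfl⟩

/-- … and for the product topology (the same topology). [folklore] -/
instance borelSpace_matrix' : @BorelSpace (MatC N) inferInstance matrixBorel := ⟨rfl⟩

/-- `M_N(ℂ)` is complete (finite-dimensional). [folklore] -/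
instance completeSpace_matrix : CompleteSpace (MatC N) := FiniteDimensional.complete ℝ (MatC N)

/-- THE GENERATOR AS A LINEAR ISOMETRIC EMBEDDING `E_N → M_N(ℂ)` (orthonormal coordinates followed by the inclusion of
`𝔰𝔲(N)`). [folklore] -/
def genSUli : ChartSU N →ₗᵢ[ℝ] (MatC N) := (lieSU (Fin N)).subtypeₗᵢ.comp (coordSU (N := N)).toLinearIsometry

/-- STEP 1's continuous linear chart map `genSUL` (`ShellMeasureExpDuhamelSUN`) has the isometry's underlying linear
map. [folklore] -/
theorem coe_genSUL : (genSUL (N := N) : ChartSU N →ₗ[ℝ] MatC N) = (genSUli (N := N)).toLinearMap :=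
  LinearMap.ext fun _ => rfl

/-- `genSUL` is injective. [folklore] -/
theorem genSUL_injective : Injective (genSUL (N := N)) := fun _ _ h => (genSUli (N := N)).injective h

/-- THE AMBIENT CHART MAP `expM v = exp (genSU v)` (the matrix of the chart point `expPtSU v`). [folklore] -/
def expM (v : ChartSU N) : (MatC N) := ((expPtSU v : SUN N) : (MatC N))

/-- `expM v = exp (genSU v)`. [folklore] -/
theorem expM_apply (v : ChartSU N) : expM v = NormedSpace.exp (genSU v) := rfl
/-- the image of a chart-side set under `expM` is the matrix image of its image under `expPtSU`. [folklore] -/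
theorem image_expM (s : Set (ChartSU N)) : expM '' s = Subtype.val '' (expPtSU '' s) := by
  rw [show expM (N := N) = Subtype.val ∘ expPtSU from rfl, image_comp]

/-- `expM = exp ∘ genSUL` is smooth. [folklore] -/
theorem contDiff_expM {n : WithTop ℕ∞} : ContDiff ℝ n (expM (N := N)) :=
  Literature.Analysis.Calculus.contDiff_exp.comp (genSUL (N := N)).contDiff

/-- `expM` is continuous. [folklore] -/
theorem continuous_expM : Continuous (expM (N := N)) := contDiff_expM (n := 0) |>.continuous
/-- **AT THE CENTRE THE CHART IS THE ISOMETRIC EMBEDDING TO FIRST ORDER**: `expM` has strict derivative `genSUL` at `0`.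
[folklore] -/
theorem hasStrictFDerivAt_expM_zero : HasStrictFDerivAt (expM (N := N)) genSUL 0 := by
  have h1 : HasStrictFDerivAt (fun X : MatC N => NormedSpace.exp X) (1 : MatC N →L[ℝ] MatC N)
      (genSUL (0 : ChartSU N)) := by
    rw [map_zero]; exact hasStrictFDerivAt_exp_zero
  have h := h1.comp (0 : ChartSU N) (genSUL (N := N)).hasStrictFDerivAt
  exact h.congr_fderiv (ContinuousLinearMap.ext fun v => rfl)

/-- `expM` is Lipschitz on every ball. [folklore] -/
theorem exists_lipschitzOnWith_expM (R : ℝ) :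
    ∃ K : ℝ≥0, LipschitzOnWith K (expM (N := N)) (closedBall 0 R) :=
  (contDiff_expM (N := N) (n := 1)).contDiffOn.exists_lipschitzOnWith one_ne_zero (convex_closedBall 0 R)
    (isCompact_closedBall 0 R)

/-- **THE CHART IMAGE OF A BALL HAS FINITE `d_N`-DIMENSIONAL HAUSDORFF MEASURE** (Lipschitz image of a ball of
`E_N = ℝ^{d_N}`). [folklore] -/
theorem hausdorffMeasure_image_closedBall_lt_top (R : ℝ) :
    μHE[dimSU N] (expM '' closedBall (0 : ChartSU N) R) < ∞ := by
  obtain ⟨K, hK⟩ := exists_lipschitzOnWith_expM (N := N) R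
  have h := hK.hausdorffMeasure_image_le (d := (dimSU N : ℝ)) (Nat.cast_nonneg _)
  have hE : μHE[dimSU N] (closedBall (0 : ChartSU N) R) < ∞ := by
    rw [EuclideanSpace.euclideanHausdorffMeasure_eq_volume]
    exact measure_closedBall_lt_top
  rw [euclideanHausdorffMeasure_def, Measure.smul_apply, ENNReal.smul_def, smul_eq_mul] at hE ⊢
  set c : ℝ≥0∞ := (addHaarScalarFactor (volume : Measure (EuclideanSpace ℝ (Fin (dimSU N)))) μH[dimSU N] : ℝ≥0∞)
  calc c * μH[dimSU N] (expM '' closedBall (0 : ChartSU N) R)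
      ≤ c * ((K : ℝ≥0∞) ^ (dimSU N : ℝ) * μH[dimSU N] (closedBall (0 : ChartSU N) R)) := by gcongr
    _ = (K : ℝ≥0∞) ^ (dimSU N : ℝ) * (c * μH[dimSU N] (closedBall (0 : ChartSU N) R)) := by ring
    _ < ∞ := ENNReal.mul_lt_top (ENNReal.rpow_lt_top_of_nonneg (Nat.cast_nonneg _) ENNReal.coe_ne_top) hE

/-- **A CHART NEIGHBOURHOOD OF THE CENTRE HAS POSITIVE `d_N`-DIMENSIONAL HAUSDORFF MEASURE**: there is a neighbourhood
`s` of `0 ∈ E_N` with `0 < μHE[d_N] (expM '' s)` (the chart is `δ`-approximately the isometric embedding `genSUL` near `0`).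
[folklore] -/
theorem exists_nhds_hausdorffMeasure_image_pos :
    ∃ s ∈ 𝓝 (0 : ChartSU N), 0 < μHE[dimSU N] (expM '' s) := by
  letI : InnerProductSpace ℝ (MatC N) := hsInnerProductSpace
  have hm : ((1 / 2 : ℝ≥0) : ℝ≥0∞) < ENNReal.ofReal (genSUL (N := N) : ChartSU N →ₗ[ℝ] (MatC N)).normDet := by
    rw [coe_genSUL, (genSUli (N := N)).normDet_eq_one, ENNReal.ofReal_one, ENNReal.coe_div two_ne_zero,
      ENNReal.coe_one, ENNReal.coe_ofNat, one_div]
    exact ENNReal.inv_lt_one.mpr ENNReal.one_lt_two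
  have hev := Literature.Analysis.Calculus.mul_le_euclideanHausdorffMeasure_image_of_lt_normDet
    (genSUL_injective (N := N)) hm
  obtain ⟨δ, hδ, hδpos⟩ := (hev.and self_mem_nhdsWithin).exists
  obtain ⟨s, hs, happ⟩ := (hasStrictFDerivAt_expM_zero (N := N)).approximates_deriv_on_nhds (c := δ)
    (Or.inr hδpos)
  refine ⟨s, hs, ?_⟩
  have h := hδ s expM happ
  rw [finrank_euclideanSpace_fin] at h
  have hvol : 0 < (volume : Measure (ChartSU N)) s := measure_pos_of_mem_nhds volume hs
  have hhalf : ((1 / 2 : ℝ≥0) : ℝ≥0∞) ≠ 0 := by simp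
  exact lt_of_lt_of_le (ENNReal.mul_pos hhalf hvol.ne') h

/-! ## §3 The `d_N`-dimensional Hausdorff measure of `SU(N)`: a finite, non-zero, left-invariant Borel measure -/

/-- the Borel structure of `SU(N)` (the tree's `Matrix.specialUnitaryGroup.instMeasurableSpace`) is Borel for the
Frobenius metric topology of the subtype (the same topology). [folklore] -/
instance borelSpace_SUN :
    @BorelSpace (SUN N) (PseudoMetricSpace.toUniformSpace (α := SUN N)).toTopologicalSpace inferInstance := ⟨rfl⟩

/-- **THE `d_N`-DIMENSIONAL EUCLIDEAN HAUSDORFF MEASURE OF `SU(N) ⊂ (M_N(ℂ), Re Tr A*B)`** as a measure on the group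
(`d_N = dim_ℝ 𝔰𝔲(N)`; Mathlib's `μHE[d]`, normalised to agree with Lebesgue measure on `d`-dimensional Euclidean
space). [folklore] -/
def hausdorffSU (N : ℕ) : Measure (SUN N) := μHE[dimSU N]

/-- the inclusion `SU(N) ↪ M_N(ℂ)` is an isometry, so it transports `μHE[d_N]`: the ambient Hausdorff measure of the
matrix image of a subset of the group is its `hausdorffSU` measure. [folklore] -/
theorem hausdorff_image_val (s : Set (SUN N)) :
    (μHE[dimSU N] : Measure (MatC N)) (Subtype.val '' s) = hausdorffSU N s := by
  have hiso : Isometry (Subtype.val : SUN N → (MatC N)) := isometry_subtype_coe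
  exact @Isometry.euclideanHausdorffMeasure_image (SUN N) (MatC N) _ Matrix.specialUnitaryGroup.instMeasurableSpace
    borelSpace_SUN _ _ _ Subtype.val (dimSU N) hiso s

/-- … in particular for chart images: `μHE[d_N] (expM '' s) = hausdorffSU N (expPtSU '' s)`. [folklore] -/
theorem hausdorff_image_expM (s : Set (ChartSU N)) :
    (μHE[dimSU N] : Measure (MatC N)) (expM '' s) = hausdorffSU N (expPtSU '' s) := by
  rw [image_expM, hausdorff_image_val]

/-- left multiplication by a unitary preserves the Hilbert–Schmidt norm. [folklore] -/
theorem norm_unitary_mul {U : (MatC N)} (hU : U ∈ Matrix.unitaryGroup (Fin N) ℂ) (A : (MatC N)) : ‖U * A‖ = ‖A‖ := by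
  letI : InnerProductSpace ℝ (MatC N) := hsInnerProductSpace
  have hUU : Uᴴ * U = 1 := by rw [← Matrix.star_eq_conjTranspose]; exact Matrix.mem_unitaryGroup_iff'.mp hU
  have h : ‖U * A‖ ^ 2 = ‖A‖ ^ 2 := by
    rw [← real_inner_self_eq_norm_sq, ← real_inner_self_eq_norm_sq, frobenius_inner_def, frobenius_inner_def,
      Matrix.conjTranspose_mul, Matrix.mul_assoc, ← Matrix.mul_assoc Uᴴ, hUU, Matrix.one_mul]
  nlinarith [norm_nonneg (U * A), norm_nonneg A]

/-- **LEFT TRANSLATIONS OF `SU(N)` ARE ISOMETRIES** of the Hilbert–Schmidt metric. [folklore] -/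
theorem isometry_mul_left (g : SUN N) : Isometry fun h : SUN N => g * h := by
  refine Isometry.of_dist_eq fun a b => ?_
  rw [Subtype.dist_eq, Subtype.dist_eq, dist_eq_norm, dist_eq_norm, Submonoid.coe_mul, Submonoid.coe_mul,
    ← Matrix.mul_sub]
  exact norm_unitary_mul (Matrix.mem_specialUnitaryGroup_iff.mp g.2).1 _

/-- left translation as a self-isometry of `SU(N)`. [folklore] -/
def mulLeftIsometry (g : SUN N) : SUN N ≃ᵢ SUN N :=
  { Equiv.mulLeft g with isometry_toFun := isometry_mul_left g }

/-- **`hausdorffSU` IS LEFT-INVARIANT.** [folklore] -/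
theorem map_mul_left_hausdorffSU (g : SUN N) :
    (hausdorffSU N).map (fun h => g * h) = hausdorffSU N :=
  ((mulLeftIsometry g).measurePreserving_euclideanHausdorffMeasure (dimSU N)).map_eq

/-- (the same, as an instance-shaped statement). [folklore] -/
theorem isMulLeftInvariant_hausdorffSU : (hausdorffSU N).IsMulLeftInvariant := ⟨map_mul_left_hausdorffSU⟩

variable (N) in
/-- THE CHART NEIGHBOURHOOD OF `1`: `Σ |(W − 1)_ij|² < (3(N+1))⁻²`. [folklore] -/
def nbhdOne : Set (SUN N) :=
  {W | ∑ i, ∑ j, ‖((W : (MatC N)) - 1) i j‖ ^ 2 < (1 / (3 * ((N : ℝ) + 1))) ^ 2}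

/-- membership in the chart neighbourhood, unfolded. [folklore] -/
theorem mem_nbhdOne_iff (W : SUN N) :
    W ∈ nbhdOne N ↔ ∑ i, ∑ j, ‖((W : (MatC N)) - 1) i j‖ ^ 2 < (1 / (3 * ((N : ℝ) + 1))) ^ 2 := Iff.rfl

/-- it is open. [folklore] -/
theorem isOpen_nbhdOne : IsOpen (nbhdOne N) := by
  refine isOpen_lt ?_ continuous_const
  refine continuous_finsetSum _ fun i _ => continuous_finsetSum _ fun j _ => ?_
  exact (((continuous_subtype_val (p := fun A : (MatC N) => A ∈ Matrix.specialUnitaryGroup (Fin N) ℂ)).sub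
    continuous_const).matrix_elem i j).norm.pow 2

/-- it contains `1`. [folklore] -/
theorem one_mem_nbhdOne : (1 : SUN N) ∈ nbhdOne N := by
  rw [mem_nbhdOne_iff, OneMemClass.coe_one, sub_self]
  simp only [Matrix.zero_apply, norm_zero, ne_eq, OfNat.ofNat_ne_zero, not_false_eq_true, zero_pow,
    Finset.sum_const_zero]
  positivity

/-- **THE CHART NEIGHBOURHOOD LIES IN THE CHART IMAGE OF THE BALL OF RADIUS `N`.** [folklore] -/
theorem nbhdOne_subset_image : nbhdOne N ⊆ expPtSU '' closedBall (0 : ChartSU N) N := by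
  intro W hW
  obtain ⟨Z, hZ, hexp, hsum⟩ := exists_lieSU_exp_eq W.2 ((mem_nbhdOne_iff W).mp hW)
  refine ⟨(coordSU (N := N)).symm ⟨Z, hZ⟩, ?_, ?_⟩
  · rw [mem_closedBall, dist_zero_right, LinearIsometryEquiv.norm_map]
    have h1 : ‖(⟨Z, hZ⟩ : lieSU (Fin N))‖ = ‖Z‖ := rfl
    have h2 : ‖Z‖ ^ 2 = ∑ i, ∑ j, ‖Z i j‖ ^ 2 := by
      letI : InnerProductSpace ℝ (MatC N) := hsInnerProductSpace
      rw [← real_inner_self_eq_norm_sq, frobenius_inner_def, MatrixNorms.sum_norm_sq_eq_re_trace]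
    have h3 : (N : ℝ) ≤ (N : ℝ) ^ 2 := by
      rcases Nat.eq_zero_or_pos N with h0 | h0
      · simp [h0]
      · exact_mod_cast Nat.le_self_pow two_ne_zero N
    rw [h1]
    nlinarith [norm_nonneg Z, Nat.cast_nonneg (α := ℝ) N]
  · apply Subtype.ext
    rw [coe_expPtSU, ← hexp, genSU, LinearIsometryEquiv.apply_symm_apply]

/-- the chart neighbourhood has finite Hausdorff measure. [folklore] -/
theorem hausdorffSU_nbhdOne_lt_top : hausdorffSU N (nbhdOne N) < ∞ :=
  calc hausdorffSU N (nbhdOne N) ≤ hausdorffSU N (expPtSU '' closedBall (0 : ChartSU N) N) :=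
        measure_mono nbhdOne_subset_image
    _ = (μHE[dimSU N] : Measure (MatC N)) (expM '' closedBall (0 : ChartSU N) N) := (hausdorff_image_expM _).symm
    _ < ∞ := hausdorffMeasure_image_closedBall_lt_top N

/-- **`hausdorffSU` IS FINITE** (finitely many translates of the chart neighbourhood cover the compact group).
[folklore] -/
theorem hausdorffSU_univ_lt_top : hausdorffSU N univ < ∞ := by
  obtain ⟨t, ht⟩ := compact_covered_by_mul_left_translates (G := SUN N) isCompact_univ (V := nbhdOne N)
    ⟨1, by rw [isOpen_nbhdOne.interior_eq]; exact one_mem_nbhdOne⟩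
  have hmeas : ∀ g : SUN N, Measurable fun h : SUN N => g * h := fun g =>
    (continuous_const.mul continuous_id).measurable
  calc hausdorffSU N univ ≤ hausdorffSU N (⋃ g ∈ t, (fun h => g * h) ⁻¹' nbhdOne N) := measure_mono ht
    _ ≤ ∑ g ∈ t, hausdorffSU N ((fun h => g * h) ⁻¹' nbhdOne N) := measure_biUnion_finset_le t _
    _ = ∑ _g ∈ t, hausdorffSU N (nbhdOne N) := Finset.sum_congr rfl fun g _ => by
        rw [← Measure.map_apply (hmeas g) isOpen_nbhdOne.measurableSet, map_mul_left_hausdorffSU]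
    _ < ∞ := by rw [Finset.sum_const, nsmul_eq_mul]; exact ENNReal.mul_lt_top (by simp) hausdorffSU_nbhdOne_lt_top

/-- **`hausdorffSU` IS NON-ZERO.** [folklore] -/
theorem hausdorffSU_univ_pos : 0 < hausdorffSU N univ := by
  obtain ⟨s, -, hpos⟩ := exists_nhds_hausdorffMeasure_image_pos (N := N)
  calc (0 : ℝ≥0∞) < (μHE[dimSU N] : Measure (MatC N)) (expM '' s) := hpos
    _ = hausdorffSU N (expPtSU '' s) := hausdorff_image_expM s
    _ ≤ hausdorffSU N univ := measure_mono (subset_univ _)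

/-! ## §4 Haar measure of `SU(N)` IS the normalised Hausdorff measure -/

variable [NeZero N]

/-- **HAAR = NORMALISED HAUSDORFF ON `SU(N)`.**  The normalised Haar measure of `SU(N)` (the tree's `HaarData.haar` =
`haarProbability (SUN N)` = Mathlib's `haarMeasure ⊤`) is the `d_N`-dimensional Euclidean Hausdorff measure of
`SU(N) ⊂ (M_N(ℂ), Re Tr A*B)` divided by its (finite, non-zero) total mass — uniqueness of left-invariant measures on
the compact group. [folklore] -/
theorem haar_eq_smul_hausdorffSU :
    (HaarData.haar : Measure (SUN N)) = (hausdorffSU N univ)⁻¹ • hausdorffSU N := by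
  haveI : IsFiniteMeasure (hausdorffSU N) := ⟨hausdorffSU_univ_lt_top⟩
  haveI : (hausdorffSU N).IsMulLeftInvariant := isMulLeftInvariant_hausdorffSU
  haveI : SecondCountableTopology (SUN N) := by
    haveI : SecondCountableTopology (MatC N) := inferInstanceAs (SecondCountableTopology (Fin N → Fin N → ℂ))
    exact Topology.IsEmbedding.subtypeVal.secondCountableTopology
  set c : ℝ≥0∞ := hausdorffSU N univ with hc
  have h := Measure.haarMeasure_unique (hausdorffSU N) (⊤ : TopologicalSpace.PositiveCompacts (SUN N))
  rw [TopologicalSpace.PositiveCompacts.coe_top, ← hc] at h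
  change Measure.haarMeasure ⊤ = c⁻¹ • hausdorffSU N
  rw [h, smul_smul, ENNReal.inv_mul_cancel hausdorffSU_univ_pos.ne' hausdorffSU_univ_lt_top.ne, one_smul]

/-- **HAAR MEASURE OF A CHART IMAGE, AMBIENTLY**: for every `s ⊆ E_N`,
`Haar (expPtSU '' s) = μHE[d_N] (exp (genSU '' s)) / μHE[d_N] (SU(N))` — the form the area formula consumes.
[folklore] -/
theorem haar_image_expPtSU (s : Set (ChartSU N)) :
    (HaarData.haar : Measure (SUN N)) (expPtSU '' s) =
      (hausdorffSU N univ)⁻¹ * (μHE[dimSU N] : Measure (MatC N)) (expM '' s) := by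
  rw [haar_eq_smul_hausdorffSU, Measure.smul_apply, smul_eq_mul, hausdorff_image_expM]

end Frobenius

end Summit.QuantumFields.BalabanUV.T4Continuum.ShellMeasureHaarHausdorffSUN

end
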